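import Summits.AtomisticToContinuum.HydrodynamicLimit.Theorems.CollisionIsometryCLTAdaptedWeightCLTBHContactToMassModulusLoss

/-!
# Stub `stub_contactToMass` (S4) of the line `block-h-dissipation-closure`, helper file 8: the REAL-FORM MODULUS of
the normalised Hellinger dissipation in the flux-weighted `L¹` distance
(crux `CollisionIsometryCLT.AdaptedWeightCLT`, stmt-AtomisticToContinuum-14868; `--supports`, anchor
`bhContactToMass_modulusReal_anchor`)

Step (a) of the repair plan of `stub_contactToMass`, second half. For a reference velocity `u` let
`S_u(f₁,f₂) = ∫‖·−u‖Δ · ∫f₁ + ∫Δ · ∫‖·−u‖f₁ + ∫‖·−u‖f₂ · ∫Δ + ∫f₂ · ∫‖·−u‖Δ`, `Δ = |f₁ − f₂|` (`fluxL1` of helper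
file 7: a FLUX-WEIGHTED `L¹` DISTANCE) and `|S²| = sphereArea` (ibid.). No definitions here. For measurable `f₁, f₂ ≥ 0` with `B fᵢ fᵢ_*`, `fᵢ`, `‖·−u‖fᵢ`
integrable:
* `abs_fluxZ_sub_le` — `|Z(f₁) − Z(f₂)| ≤ |S²| S_u` (pointwise `B|f₁f₁_* − f₂f₂_*| ≤ (‖v−u‖+‖v_*−u‖)(f₁_*|Δ| + f₂|Δ_*|)`,
  then the product structure of `dv dv_* dω`, `lintegral_fluxDiff_le`);
* `lossDist_le` — `D(f₁,f₂) ≤ 2|S²| S_u` (the landed `lintegral_lossDist_le`, made real);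
* `hellDiss_sub_le` — **THE MODULUS**: `𝒟h(f₁) − 𝒟h(f₂) ≤ (5|S²| S_u + 4 √(|S²| S_u Z(f₂))) / Z(f₁)` when `Z(f₁) > 0`,
  and the symmetric `abs_hellDiss_sub_le`.
So `𝒟h ∘ cellLaw` moves by `O(√r + r)`, `r = S_u / Z`, the RELATIVE flux-weighted moved mass — uniformly, with a flux
lower bound needed only for the law whose dissipation is bounded from above (the LATER time in the charging argument).
-/

namespace Summit.AtomisticToContinuum.HydrodynamicLimit.Theorems.BlockHDissipation

open scoped BigOperators Topology Classical MeasureTheory ENNReal InnerProductSpace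
open Filter Set MeasureTheory
open Literature.Analysis.FluidPDE
open Summit.AtomisticToContinuum.HydrodynamicLimit.Theorems.ContactSourceDuhamel (T3 V3 Cfg Vel Flow Flows)
open Literature.MathematicalPhysics.KineticTheory (collide hardSphereKernel sphereMeasure)

noncomputable section

namespace ContactToMass

variable {f₁ f₂ : V3 → ℝ}

/-! ## The flux difference and the loss distance against the flux-weighted `L¹` distance -/

section FluxL1

variable (u : V3)

/-- Pointwise: `B |f₁f₁_* − f₂f₂_*| ≤ (‖v−u‖ + ‖v_*−u‖)(f₁(v_*)|f₁(v) − f₂(v)| + f₂(v)|f₁(v_*) − f₂(v_*)|)`. -/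
theorem kernel_mul_abs_pair_sub_le (h₁ : ∀ v, 0 ≤ f₁ v) (h₂ : ∀ v, 0 ≤ f₂ v) (q : PairDir) :
    hardSphereKernel q.1 q.2 * |f₁ q.1.1 * f₁ q.1.2 - f₂ q.1.1 * f₂ q.1.2| ≤
      (‖q.1.1 - u‖ + ‖q.1.2 - u‖) * (f₁ q.1.2 * |f₁ q.1.1 - f₂ q.1.1| + f₂ q.1.1 * |f₁ q.1.2 - f₂ q.1.2|) := by
  have hB0 : 0 ≤ hardSphereKernel q.1 q.2 := le_max_right _ _
  have hB := hardSphereKernel_le_norm_add q.1 q.2 u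
  have hsplit : |f₁ q.1.1 * f₁ q.1.2 - f₂ q.1.1 * f₂ q.1.2| ≤
      f₁ q.1.2 * |f₁ q.1.1 - f₂ q.1.1| + f₂ q.1.1 * |f₁ q.1.2 - f₂ q.1.2| := by
    have e : f₁ q.1.1 * f₁ q.1.2 - f₂ q.1.1 * f₂ q.1.2 =
        f₁ q.1.2 * (f₁ q.1.1 - f₂ q.1.1) + f₂ q.1.1 * (f₁ q.1.2 - f₂ q.1.2) := by ring
    rw [e]
    refine (abs_add_le _ _).trans (le_of_eq ?_)
    rw [abs_mul, abs_mul, abs_of_nonneg (h₁ _), abs_of_nonneg (h₂ _)]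
  have hR : 0 ≤ f₁ q.1.2 * |f₁ q.1.1 - f₂ q.1.1| + f₂ q.1.1 * |f₁ q.1.2 - f₂ q.1.2| := by
    have := h₁ q.1.2; have := h₂ q.1.1; positivity
  calc hardSphereKernel q.1 q.2 * |f₁ q.1.1 * f₁ q.1.2 - f₂ q.1.1 * f₂ q.1.2|
      ≤ hardSphereKernel q.1 q.2 * (f₁ q.1.2 * |f₁ q.1.1 - f₂ q.1.1| + f₂ q.1.1 * |f₁ q.1.2 - f₂ q.1.2|) :=
        mul_le_mul_of_nonneg_left hsplit hB0
    _ ≤ _ := mul_le_mul_of_nonneg_right hB hR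

/-- The flux difference in lower integrals: `∫⁻ B|L₁ − L₂| ≤ |S²| · (the four products of `lintegral_lossDist_le`)`. -/
theorem lintegral_fluxDiff_le (hf₁ : Measurable f₁) (hf₂ : Measurable f₂) (h₁ : ∀ v, 0 ≤ f₁ v) (h₂ : ∀ v, 0 ≤ f₂ v) :
    ∫⁻ q : PairDir, ENNReal.ofReal (hardSphereKernel q.1 q.2 * |f₁ q.1.1 * f₁ q.1.2 - f₂ q.1.1 * f₂ q.1.2|)
        ∂pairDirMeasure ≤
      sphereMeasure (Set.univ : Set (Metric.sphere (0 : V3) 1)) *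
        ((∫⁻ v, ENNReal.ofReal (‖v - u‖ * |f₁ v - f₂ v|)) * (∫⁻ v, ENNReal.ofReal (f₁ v)) +
          (∫⁻ v, ENNReal.ofReal |f₁ v - f₂ v|) * (∫⁻ v, ENNReal.ofReal (‖v - u‖ * f₁ v)) +
          (∫⁻ v, ENNReal.ofReal (‖v - u‖ * f₂ v)) * (∫⁻ v, ENNReal.ofReal |f₁ v - f₂ v|) +
          (∫⁻ v, ENNReal.ofReal (f₂ v)) * (∫⁻ v, ENNReal.ofReal (‖v - u‖ * |f₁ v - f₂ v|))) := by
  set φ₁ : V3 → ℝ≥0∞ := fun v => ENNReal.ofReal (‖v - u‖ * |f₁ v - f₂ v|) with hφ₁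
  set φ₂ : V3 → ℝ≥0∞ := fun v => ENNReal.ofReal |f₁ v - f₂ v| with hφ₂
  set χ₁ : V3 → ℝ≥0∞ := fun v => ENNReal.ofReal (f₁ v) with hχ₁
  set χ₂ : V3 → ℝ≥0∞ := fun v => ENNReal.ofReal (‖v - u‖ * f₁ v) with hχ₂
  set χ₃ : V3 → ℝ≥0∞ := fun v => ENNReal.ofReal (‖v - u‖ * f₂ v) with hχ₃
  set χ₄ : V3 → ℝ≥0∞ := fun v => ENNReal.ofReal (f₂ v) with hχ₄
  have hΔ : Measurable fun v => |f₁ v - f₂ v| := (hf₁.sub hf₂).abs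
  have hnu : Measurable fun v : V3 => ‖v - u‖ := (measurable_id.sub_const u).norm
  have mφ₁ : Measurable φ₁ := (hnu.mul hΔ).ennreal_ofReal
  have mφ₂ : Measurable φ₂ := hΔ.ennreal_ofReal
  have mχ₁ : Measurable χ₁ := hf₁.ennreal_ofReal
  have mχ₂ : Measurable χ₂ := (hnu.mul hf₁).ennreal_ofReal
  have mχ₃ : Measurable χ₃ := (hnu.mul hf₂).ennreal_ofReal
  have mχ₄ : Measurable χ₄ := hf₂.ennreal_ofReal
  have hpt : ∀ q : PairDir, ENNReal.ofReal (hardSphereKernel q.1 q.2 * |f₁ q.1.1 * f₁ q.1.2 - f₂ q.1.1 * f₂ q.1.2|) ≤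
      φ₁ q.1.1 * χ₁ q.1.2 + φ₂ q.1.1 * χ₂ q.1.2 + χ₃ q.1.1 * φ₂ q.1.2 + χ₄ q.1.1 * φ₁ q.1.2 := by
    intro q
    have h := kernel_mul_abs_pair_sub_le u h₁ h₂ q
    have hv := h₁ q.1.2
    have hw := h₂ q.1.1
    have hn1 : 0 ≤ ‖q.1.1 - u‖ := norm_nonneg _
    have hn2 : 0 ≤ ‖q.1.2 - u‖ := norm_nonneg _
    have ha1 : 0 ≤ |f₁ q.1.1 - f₂ q.1.1| := abs_nonneg _
    have ha2 : 0 ≤ |f₁ q.1.2 - f₂ q.1.2| := abs_nonneg _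
    set S : ℝ := ‖q.1.1 - u‖ * |f₁ q.1.1 - f₂ q.1.1| * f₁ q.1.2 + |f₁ q.1.1 - f₂ q.1.1| * (‖q.1.2 - u‖ * f₁ q.1.2) +
      ‖q.1.1 - u‖ * f₂ q.1.1 * |f₁ q.1.2 - f₂ q.1.2| + f₂ q.1.1 * (‖q.1.2 - u‖ * |f₁ q.1.2 - f₂ q.1.2|) with hS
    have e1 : φ₁ q.1.1 * χ₁ q.1.2 = ENNReal.ofReal (‖q.1.1 - u‖ * |f₁ q.1.1 - f₂ q.1.1| * f₁ q.1.2) := by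
      simp only [hφ₁, hχ₁]; rw [← ENNReal.ofReal_mul (by positivity)]
    have e2 : φ₂ q.1.1 * χ₂ q.1.2 = ENNReal.ofReal (|f₁ q.1.1 - f₂ q.1.1| * (‖q.1.2 - u‖ * f₁ q.1.2)) := by
      simp only [hφ₂, hχ₂]; rw [← ENNReal.ofReal_mul (by positivity)]
    have e3 : χ₃ q.1.1 * φ₂ q.1.2 = ENNReal.ofReal (‖q.1.1 - u‖ * f₂ q.1.1 * |f₁ q.1.2 - f₂ q.1.2|) := by
      simp only [hφ₂, hχ₃]; rw [← ENNReal.ofReal_mul (by positivity)]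
    have e4 : χ₄ q.1.1 * φ₁ q.1.2 = ENNReal.ofReal (f₂ q.1.1 * (‖q.1.2 - u‖ * |f₁ q.1.2 - f₂ q.1.2|)) := by
      simp only [hφ₁, hχ₄]; rw [← ENNReal.ofReal_mul (by positivity)]
    have hS2 : φ₁ q.1.1 * χ₁ q.1.2 + φ₂ q.1.1 * χ₂ q.1.2 + χ₃ q.1.1 * φ₂ q.1.2 + χ₄ q.1.1 * φ₁ q.1.2 = ENNReal.ofReal S := by
      rw [e1, e2, e3, e4, ← ENNReal.ofReal_add (by positivity) (by positivity),
        ← ENNReal.ofReal_add (by positivity) (by positivity), ← ENNReal.ofReal_add (by positivity) (by positivity), hS]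
    rw [hS2]
    refine ENNReal.ofReal_le_ofReal (h.trans (le_of_eq ?_))
    rw [hS]; ring
  calc ∫⁻ q : PairDir, ENNReal.ofReal (hardSphereKernel q.1 q.2 * |f₁ q.1.1 * f₁ q.1.2 - f₂ q.1.1 * f₂ q.1.2|)
        ∂pairDirMeasure
      ≤ ∫⁻ q : PairDir, (φ₁ q.1.1 * χ₁ q.1.2 + φ₂ q.1.1 * χ₂ q.1.2 + χ₃ q.1.1 * φ₂ q.1.2 + χ₄ q.1.1 * φ₁ q.1.2)
          ∂pairDirMeasure := lintegral_mono hpt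
    _ = (∫⁻ q : PairDir, φ₁ q.1.1 * χ₁ q.1.2 ∂pairDirMeasure) +
          (∫⁻ q : PairDir, φ₂ q.1.1 * χ₂ q.1.2 ∂pairDirMeasure) +
          (∫⁻ q : PairDir, χ₃ q.1.1 * φ₂ q.1.2 ∂pairDirMeasure) +
          (∫⁻ q : PairDir, χ₄ q.1.1 * φ₁ q.1.2 ∂pairDirMeasure) := by
        have m1 : Measurable fun q : PairDir => φ₁ q.1.1 * χ₁ q.1.2 :=
          (mφ₁.comp (measurable_fst.comp measurable_fst)).mul (mχ₁.comp (measurable_snd.comp measurable_fst))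
        have m2 : Measurable fun q : PairDir => φ₂ q.1.1 * χ₂ q.1.2 :=
          (mφ₂.comp (measurable_fst.comp measurable_fst)).mul (mχ₂.comp (measurable_snd.comp measurable_fst))
        have m3 : Measurable fun q : PairDir => χ₃ q.1.1 * φ₂ q.1.2 :=
          (mχ₃.comp (measurable_fst.comp measurable_fst)).mul (mφ₂.comp (measurable_snd.comp measurable_fst))
        have m4 : Measurable fun q : PairDir => χ₄ q.1.1 * φ₁ q.1.2 :=
          (mχ₄.comp (measurable_fst.comp measurable_fst)).mul (mφ₁.comp (measurable_snd.comp measurable_fst))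
        rw [lintegral_add_right _ m4, lintegral_add_right _ m3, lintegral_add_right _ m2]
    _ = _ := by
        rw [lintegral_pairDir_prod mφ₁ mχ₁, lintegral_pairDir_prod mφ₂ mχ₂, lintegral_pairDir_prod mχ₃ mφ₂,
          lintegral_pairDir_prod mχ₄ mφ₁]
        ring

variable {u}

/-- The four lower-integral products are `ofReal` of the flux-weighted `L¹` distance (integrable data). -/
theorem lintegral_products_eq (hf₁ : Measurable f₁) (hf₂ : Measurable f₂) (h₁ : ∀ v, 0 ≤ f₁ v) (h₂ : ∀ v, 0 ≤ f₂ v)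
    (hi₁ : Integrable f₁) (hi₂ : Integrable f₂) (hm₁ : Integrable fun v => ‖v - u‖ * f₁ v)
    (hm₂ : Integrable fun v => ‖v - u‖ * f₂ v) :
    (∫⁻ v, ENNReal.ofReal (‖v - u‖ * |f₁ v - f₂ v|)) * (∫⁻ v, ENNReal.ofReal (f₁ v)) +
        (∫⁻ v, ENNReal.ofReal |f₁ v - f₂ v|) * (∫⁻ v, ENNReal.ofReal (‖v - u‖ * f₁ v)) +
        (∫⁻ v, ENNReal.ofReal (‖v - u‖ * f₂ v)) * (∫⁻ v, ENNReal.ofReal |f₁ v - f₂ v|) +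
        (∫⁻ v, ENNReal.ofReal (f₂ v)) * (∫⁻ v, ENNReal.ofReal (‖v - u‖ * |f₁ v - f₂ v|)) =
      ENNReal.ofReal (fluxL1 u f₁ f₂) := by
  have hΔi : Integrable fun v => |f₁ v - f₂ v| := (hi₁.sub hi₂).abs
  have hΔ0 : ∀ v, 0 ≤ |f₁ v - f₂ v| := fun v => abs_nonneg _
  have hwΔi : Integrable fun v => ‖v - u‖ * |f₁ v - f₂ v| := by
    refine (hm₁.add hm₂).mono' ?_ (Eventually.of_forall fun v => ?_)
    · exact (((measurable_id.sub_const u).norm).mul (hf₁.sub hf₂).abs).aestronglyMeasurable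
    · rw [Real.norm_eq_abs, abs_of_nonneg (mul_nonneg (norm_nonneg _) (abs_nonneg _))]
      have hn : 0 ≤ ‖v - u‖ := norm_nonneg _
      have : |f₁ v - f₂ v| ≤ f₁ v + f₂ v := by
        rw [abs_le]; constructor <;> linarith [h₁ v, h₂ v]
      calc ‖v - u‖ * |f₁ v - f₂ v| ≤ ‖v - u‖ * (f₁ v + f₂ v) := mul_le_mul_of_nonneg_left this hn
        _ = ((fun v => ‖v - u‖ * f₁ v) + fun v => ‖v - u‖ * f₂ v) v := by simp only [Pi.add_apply]; ring
  have hwΔ0 : ∀ v, 0 ≤ ‖v - u‖ * |f₁ v - f₂ v| := fun v => mul_nonneg (norm_nonneg _) (abs_nonneg _)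
  have hw₁0 : ∀ v, 0 ≤ ‖v - u‖ * f₁ v := fun v => mul_nonneg (norm_nonneg _) (h₁ v)
  have hw₂0 : ∀ v, 0 ≤ ‖v - u‖ * f₂ v := fun v => mul_nonneg (norm_nonneg _) (h₂ v)
  rw [(ofReal_integral_eq_lintegral_ofReal hwΔi (Eventually.of_forall hwΔ0)).symm, (ofReal_integral_eq_lintegral_ofReal hi₁ (Eventually.of_forall h₁)).symm, (ofReal_integral_eq_lintegral_ofReal hΔi (Eventually.of_forall hΔ0)).symm, (ofReal_integral_eq_lintegral_ofReal hm₁ (Eventually.of_forall hw₁0)).symm,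
    (ofReal_integral_eq_lintegral_ofReal hm₂ (Eventually.of_forall hw₂0)).symm, (ofReal_integral_eq_lintegral_ofReal hi₂ (Eventually.of_forall h₂)).symm]
  have p1 : 0 ≤ ∫ v, ‖v - u‖ * |f₁ v - f₂ v| := integral_nonneg hwΔ0
  have p2 : 0 ≤ ∫ v, f₁ v := integral_nonneg h₁
  have p3 : 0 ≤ ∫ v, |f₁ v - f₂ v| := integral_nonneg hΔ0
  have p4 : 0 ≤ ∫ v, ‖v - u‖ * f₁ v := integral_nonneg hw₁0
  have p5 : 0 ≤ ∫ v, ‖v - u‖ * f₂ v := integral_nonneg hw₂0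
  have p6 : 0 ≤ ∫ v, f₂ v := integral_nonneg h₂
  rw [← ENNReal.ofReal_mul p1, ← ENNReal.ofReal_mul p3, ← ENNReal.ofReal_mul p5, ← ENNReal.ofReal_mul p6,
    ← ENNReal.ofReal_add (mul_nonneg p1 p2) (mul_nonneg p3 p4),
    ← ENNReal.ofReal_add (add_nonneg (mul_nonneg p1 p2) (mul_nonneg p3 p4)) (mul_nonneg p5 p3),
    ← ENNReal.ofReal_add (add_nonneg (add_nonneg (mul_nonneg p1 p2) (mul_nonneg p3 p4)) (mul_nonneg p5 p3)) (mul_nonneg p6 p1)]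
  rfl

/-- The flux-weighted `L¹` distance is nonnegative for `f₁, f₂ ≥ 0`. -/
theorem fluxL1_nonneg (h₁ : ∀ v, 0 ≤ f₁ v) (h₂ : ∀ v, 0 ≤ f₂ v) (u : V3) : 0 ≤ fluxL1 u f₁ f₂ := by
  unfold fluxL1
  have p1 : 0 ≤ ∫ v, ‖v - u‖ * |f₁ v - f₂ v| := integral_nonneg fun v => mul_nonneg (norm_nonneg _) (abs_nonneg _)
  have p2 : 0 ≤ ∫ v, f₁ v := integral_nonneg h₁
  have p3 : 0 ≤ ∫ v, |f₁ v - f₂ v| := integral_nonneg fun v => abs_nonneg _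
  have p4 : 0 ≤ ∫ v, ‖v - u‖ * f₁ v := integral_nonneg fun v => mul_nonneg (norm_nonneg _) (h₁ v)
  have p5 : 0 ≤ ∫ v, ‖v - u‖ * f₂ v := integral_nonneg fun v => mul_nonneg (norm_nonneg _) (h₂ v)
  have p6 : 0 ≤ ∫ v, f₂ v := integral_nonneg h₂
  positivity

/-- **`|Z(f₁) − Z(f₂)| ≤ |S²| · S_u(f₁, f₂)`** for measurable `f₁, f₂ ≥ 0` with `B fᵢfᵢ_*`, `fᵢ`, `‖·−u‖fᵢ` integrable. -/
theorem abs_fluxZ_sub_le (hf₁ : Measurable f₁) (hf₂ : Measurable f₂) (h₁ : ∀ v, 0 ≤ f₁ v) (h₂ : ∀ v, 0 ≤ f₂ v)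
    (hint₁ : Integrable (fun q : PairDir => hardSphereKernel q.1 q.2 * (f₁ q.1.1 * f₁ q.1.2)) pairDirMeasure)
    (hint₂ : Integrable (fun q : PairDir => hardSphereKernel q.1 q.2 * (f₂ q.1.1 * f₂ q.1.2)) pairDirMeasure)
    (hi₁ : Integrable f₁) (hi₂ : Integrable f₂) (hm₁ : Integrable fun v => ‖v - u‖ * f₁ v)
    (hm₂ : Integrable fun v => ‖v - u‖ * f₂ v) :
    |fluxZ f₁ - fluxZ f₂| ≤ sphereArea * fluxL1 u f₁ f₂ := by
  have hsub : fluxZ f₁ - fluxZ f₂ = ∫ q : PairDir, (hardSphereKernel q.1 q.2 * (f₁ q.1.1 * f₁ q.1.2) -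
      hardSphereKernel q.1 q.2 * (f₂ q.1.1 * f₂ q.1.2)) ∂pairDirMeasure := by
    rw [fluxZ, fluxZ, ← integral_sub hint₁ hint₂]
  have hnorm := norm_integral_le_integral_norm (μ := pairDirMeasure) (fun q : PairDir =>
    hardSphereKernel q.1 q.2 * (f₁ q.1.1 * f₁ q.1.2) - hardSphereKernel q.1 q.2 * (f₂ q.1.1 * f₂ q.1.2))
  rw [← hsub, Real.norm_eq_abs] at hnorm
  refine hnorm.trans ?_
  have hB0 : ∀ q : PairDir, 0 ≤ hardSphereKernel q.1 q.2 := fun q => le_max_right _ _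
  have hpt : ∀ q : PairDir, ‖hardSphereKernel q.1 q.2 * (f₁ q.1.1 * f₁ q.1.2) - hardSphereKernel q.1 q.2 * (f₂ q.1.1 * f₂ q.1.2)‖ =
      hardSphereKernel q.1 q.2 * |f₁ q.1.1 * f₁ q.1.2 - f₂ q.1.1 * f₂ q.1.2| := by
    intro q
    rw [Real.norm_eq_abs, ← mul_sub, abs_mul, abs_of_nonneg (hB0 q)]
  simp_rw [hpt]
  have hmeas : AEStronglyMeasurable (fun q : PairDir => hardSphereKernel q.1 q.2 *
      |f₁ q.1.1 * f₁ q.1.2 - f₂ q.1.1 * f₂ q.1.2|) pairDirMeasure :=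
    (DVTransfer.continuous_hardSphereKernel_pairDir.measurable.mul
      (((hf₁.comp (measurable_fst.comp measurable_fst)).mul (hf₁.comp (measurable_snd.comp measurable_fst))).sub
        ((hf₂.comp (measurable_fst.comp measurable_fst)).mul (hf₂.comp (measurable_snd.comp measurable_fst)))).abs).aestronglyMeasurable
  have hnn : 0 ≤ᵐ[pairDirMeasure] fun q : PairDir => hardSphereKernel q.1 q.2 * |f₁ q.1.1 * f₁ q.1.2 - f₂ q.1.1 * f₂ q.1.2| :=
    Eventually.of_forall fun q => mul_nonneg (hB0 q) (abs_nonneg _)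
  rw [integral_eq_lintegral_of_nonneg_ae hnn hmeas]
  have hlin := lintegral_fluxDiff_le u hf₁ hf₂ h₁ h₂
  rw [lintegral_products_eq hf₁ hf₂ h₁ h₂ hi₁ hi₂ hm₁ hm₂, ← ofReal_sphereArea,
    ← ENNReal.ofReal_mul sphereArea_nonneg] at hlin
  have hfin : ENNReal.ofReal (sphereArea * fluxL1 u f₁ f₂) ≠ ⊤ := ENNReal.ofReal_ne_top
  have := ENNReal.toReal_mono hfin hlin
  rwa [ENNReal.toReal_ofReal (mul_nonneg sphereArea_nonneg (fluxL1_nonneg h₁ h₂ u))] at this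

/-- **`D(f₁, f₂) ≤ 2|S²| · S_u(f₁, f₂)`** (the landed `lintegral_lossDist_le`, made real). -/
theorem lossDist_le (hf₁ : Measurable f₁) (hf₂ : Measurable f₂) (h₁ : ∀ v, 0 ≤ f₁ v) (h₂ : ∀ v, 0 ≤ f₂ v)
    (hint₁ : Integrable (fun q : PairDir => hardSphereKernel q.1 q.2 * (f₁ q.1.1 * f₁ q.1.2)) pairDirMeasure)
    (hint₂ : Integrable (fun q : PairDir => hardSphereKernel q.1 q.2 * (f₂ q.1.1 * f₂ q.1.2)) pairDirMeasure)
    (hi₁ : Integrable f₁) (hi₂ : Integrable f₂) (hm₁ : Integrable fun v => ‖v - u‖ * f₁ v)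
    (hm₂ : Integrable fun v => ‖v - u‖ * f₂ v) :
    lossDist f₁ f₂ ≤ 2 * sphereArea * fluxL1 u f₁ f₂ := by
  have hlin := lintegral_lossDist_le hf₁ hf₂ h₁ h₂ u
  have eD : (∫⁻ q : PairDir, ENNReal.ofReal (hardSphereKernel q.1 q.2 *
      (Real.sqrt (f₁ q.1.1 * f₁ q.1.2) - Real.sqrt (f₂ q.1.1 * f₂ q.1.2)) ^ 2) ∂pairDirMeasure) =
      ENNReal.ofReal (lossDist f₁ f₂) :=
    (ofReal_integral_eq_lintegral_ofReal (integrable_lossDist_integrand hf₁ hf₂ h₁ h₂ hint₁ hint₂)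
      (Eventually.of_forall fun q => mul_nonneg (le_max_right _ _) (sq_nonneg _))).symm
  have hR : (2 : ℝ≥0∞) * sphereMeasure (Set.univ : Set (Metric.sphere (0 : V3) 1)) * ENNReal.ofReal (fluxL1 u f₁ f₂) =
      ENNReal.ofReal (2 * sphereArea * fluxL1 u f₁ f₂) := by
    rw [ENNReal.ofReal_mul (mul_nonneg zero_le_two sphereArea_nonneg), ENNReal.ofReal_mul (by norm_num : (0 : ℝ) ≤ 2),
      ENNReal.ofReal_ofNat, ofReal_sphereArea]
  rw [lintegral_products_eq hf₁ hf₂ h₁ h₂ hi₁ hi₂ hm₁ hm₂, eD, hR] at hlin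
  exact (ENNReal.ofReal_le_ofReal_iff (mul_nonneg (mul_nonneg zero_le_two sphereArea_nonneg) (fluxL1_nonneg h₁ h₂ u))).1 hlin

/-- **THE MODULUS (real form).** For measurable `f₁, f₂ ≥ 0` with `B fᵢfᵢ_*`, `fᵢ`, `‖·−u‖fᵢ` integrable and
`Z(f₁) > 0`: `𝒟h(f₁) − 𝒟h(f₂) ≤ (5|S²| S_u + 4 √(|S²| S_u · Z(f₂))) / Z(f₁)`, `S_u = fluxL1 u f₁ f₂`. -/
theorem hellDiss_sub_le (hf₁ : Measurable f₁) (hf₂ : Measurable f₂) (h₁ : ∀ v, 0 ≤ f₁ v) (h₂ : ∀ v, 0 ≤ f₂ v)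
    (hint₁ : Integrable (fun q : PairDir => hardSphereKernel q.1 q.2 * (f₁ q.1.1 * f₁ q.1.2)) pairDirMeasure)
    (hint₂ : Integrable (fun q : PairDir => hardSphereKernel q.1 q.2 * (f₂ q.1.1 * f₂ q.1.2)) pairDirMeasure)
    (hi₁ : Integrable f₁) (hi₂ : Integrable f₂) (hm₁ : Integrable fun v => ‖v - u‖ * f₁ v)
    (hm₂ : Integrable fun v => ‖v - u‖ * f₂ v) (hZ₁ : 0 < fluxZ f₁) :
    hellDiss f₁ - hellDiss f₂ ≤
      (5 * (sphereArea * fluxL1 u f₁ f₂) + 4 * Real.sqrt (sphereArea * fluxL1 u f₁ f₂ * fluxZ f₂)) / fluxZ f₁ := by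
  set S := sphereArea * fluxL1 u f₁ f₂ with hS
  have hS0 : 0 ≤ S := mul_nonneg sphereArea_nonneg (fluxL1_nonneg h₁ h₂ u)
  have hZ₂0 : 0 ≤ fluxZ f₂ := DVTransfer.fluxZ_nonneg h₂
  have h0 := hellDiss_sub_le_of_lossDist hf₁ hf₂ h₁ h₂ hint₁ hint₂ hZ₁
  have hZ : |fluxZ f₂ - fluxZ f₁| ≤ S := by
    rw [abs_sub_comm]; exact abs_fluxZ_sub_le hf₁ hf₂ h₁ h₂ hint₁ hint₂ hi₁ hi₂ hm₁ hm₂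
  have hD : lossDist f₁ f₂ ≤ 2 * S := by
    have := lossDist_le hf₁ hf₂ h₁ h₂ hint₁ hint₂ hi₁ hi₂ hm₁ hm₂; rw [hS]; linarith
  have hD0 := lossDist_nonneg f₁ f₂
  have hsq : Real.sqrt (2 * lossDist f₁ f₂ * fluxZ f₂) ≤ 2 * Real.sqrt (S * fluxZ f₂) := by
    have h4 : 2 * lossDist f₁ f₂ * fluxZ f₂ ≤ 4 * (S * fluxZ f₂) := by nlinarith [mul_le_mul_of_nonneg_right hD hZ₂0]
    calc Real.sqrt (2 * lossDist f₁ f₂ * fluxZ f₂) ≤ Real.sqrt (4 * (S * fluxZ f₂)) := Real.sqrt_le_sqrt h4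
      _ = 2 * Real.sqrt (S * fluxZ f₂) := by
          rw [Real.sqrt_mul (by norm_num : (0 : ℝ) ≤ 4), show (4 : ℝ) = 2 ^ 2 by norm_num,
            Real.sqrt_sq (by norm_num : (0 : ℝ) ≤ 2)]
  refine h0.trans (div_le_div_of_nonneg_right ?_ hZ₁.le)
  linarith

/-- Symmetric form: `|𝒟h(f₁) − 𝒟h(f₂)| ≤ (5|S²| S_u + 4 √(|S²| S_u · max(Z(f₁), Z(f₂)))) / min(Z(f₁), Z(f₂))` when both
fluxes are positive. -/
theorem abs_hellDiss_sub_le (hf₁ : Measurable f₁) (hf₂ : Measurable f₂) (h₁ : ∀ v, 0 ≤ f₁ v) (h₂ : ∀ v, 0 ≤ f₂ v)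
    (hint₁ : Integrable (fun q : PairDir => hardSphereKernel q.1 q.2 * (f₁ q.1.1 * f₁ q.1.2)) pairDirMeasure)
    (hint₂ : Integrable (fun q : PairDir => hardSphereKernel q.1 q.2 * (f₂ q.1.1 * f₂ q.1.2)) pairDirMeasure)
    (hi₁ : Integrable f₁) (hi₂ : Integrable f₂) (hm₁ : Integrable fun v => ‖v - u‖ * f₁ v)
    (hm₂ : Integrable fun v => ‖v - u‖ * f₂ v) (hZ₁ : 0 < fluxZ f₁) (hZ₂ : 0 < fluxZ f₂) :
    |hellDiss f₁ - hellDiss f₂| ≤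
      (5 * (sphereArea * fluxL1 u f₁ f₂) +
        4 * Real.sqrt (sphereArea * fluxL1 u f₁ f₂ * max (fluxZ f₁) (fluxZ f₂))) / min (fluxZ f₁) (fluxZ f₂) := by
  set S := sphereArea * fluxL1 u f₁ f₂ with hS
  have hS0 : 0 ≤ S := mul_nonneg sphereArea_nonneg (fluxL1_nonneg h₁ h₂ u)
  have hsymm : fluxL1 u f₂ f₁ = fluxL1 u f₁ f₂ := by
    unfold fluxL1
    have e : ∀ v, |f₂ v - f₁ v| = |f₁ v - f₂ v| := fun v => abs_sub_comm _ _
    simp_rw [e]; ring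
  have h12 := hellDiss_sub_le hf₁ hf₂ h₁ h₂ hint₁ hint₂ hi₁ hi₂ hm₁ hm₂ hZ₁
  have h21 := hellDiss_sub_le hf₂ hf₁ h₂ h₁ hint₂ hint₁ hi₂ hi₁ hm₂ hm₁ hZ₂
  rw [hsymm] at h21
  have hmin0 : 0 < min (fluxZ f₁) (fluxZ f₂) := lt_min hZ₁ hZ₂
  -- common numerator bound
  have hnum : ∀ {Z : ℝ}, Z ≤ max (fluxZ f₁) (fluxZ f₂) →
      5 * S + 4 * Real.sqrt (S * Z) ≤ 5 * S + 4 * Real.sqrt (S * max (fluxZ f₁) (fluxZ f₂)) := fun hZ =>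
    by nlinarith [Real.sqrt_le_sqrt (mul_le_mul_of_nonneg_left hZ hS0)]
  have hN0 : 0 ≤ 5 * S + 4 * Real.sqrt (S * max (fluxZ f₁) (fluxZ f₂)) := by positivity
  rw [abs_le]
  constructor
  · -- `−bound ≤ 𝒟h₁ − 𝒟h₂` from `𝒟h₂ − 𝒟h₁ ≤ … / Z₂ ≤ bound`
    have h := h21.trans ((div_le_div_of_nonneg_right (hnum (le_max_left _ _)) hZ₂.le).trans
      (div_le_div_of_nonneg_left hN0 hmin0 (min_le_right _ _)))
    linarith
  · exact h12.trans ((div_le_div_of_nonneg_right (hnum (le_max_right _ _)) hZ₁.le).trans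
      (div_le_div_of_nonneg_left hN0 hmin0 (min_le_left _ _)))

end FluxL1

end ContactToMass

/-- Registration anchor of this helper file (`--supports stmt-AtomisticToContinuum-14868`, stub
`stub_contactToMass`, file 7): the real-form modulus of the normalised Hellinger dissipation in the flux-weighted
`L¹` distance — the `∀`-closed form of `ContactToMass.hellDiss_sub_le`. -/
theorem bhContactToMass_modulusReal_anchor : ∀ (u : V3) (f₁ f₂ : V3 → ℝ), Measurable f₁ → Measurable f₂ →
    (∀ v, 0 ≤ f₁ v) → (∀ v, 0 ≤ f₂ v) →
    Integrable (fun q : PairDir => hardSphereKernel q.1 q.2 * (f₁ q.1.1 * f₁ q.1.2)) pairDirMeasure →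
    Integrable (fun q : PairDir => hardSphereKernel q.1 q.2 * (f₂ q.1.1 * f₂ q.1.2)) pairDirMeasure →
    Integrable f₁ → Integrable f₂ → (Integrable fun v => ‖v - u‖ * f₁ v) → (Integrable fun v => ‖v - u‖ * f₂ v) →
    0 < fluxZ f₁ →
      hellDiss f₁ - hellDiss f₂ ≤
        (5 * (ContactToMass.sphereArea * ContactToMass.fluxL1 u f₁ f₂) +
          4 * Real.sqrt (ContactToMass.sphereArea * ContactToMass.fluxL1 u f₁ f₂ * fluxZ f₂)) / fluxZ f₁ :=
  fun _ _ _ hf₁ hf₂ h₁ h₂ hint₁ hint₂ hi₁ hi₂ hm₁ hm₂ hZ₁ =>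
    ContactToMass.hellDiss_sub_le hf₁ hf₂ h₁ h₂ hint₁ hint₂ hi₁ hi₂ hm₁ hm₂ hZ₁

end

end Summit.AtomisticToContinuum.HydrodynamicLimit.Theorems.BlockHDissipation
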